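import Summits.Ventures.PercRepro.SixFourResidueThreePieces
import Summits.Ventures.PercRepro.SixFourResidueFourBetaHolds

/-!
# PercRepro — C-025 at `(6,4)`: the residue in TWO pieces (p3, gen 11; ruling (nq)(2))

With p1's `planeAddTwoFour_holds` (`SixFourResidueFourBetaHolds.lean`: Theorem 21.6 at `t = 4` for every plane size)
three of the five named `Prop`s of the residue of record are discharged, and `SixFourResidue` — hence C-025 at `(6,4)`
on every finite matroid — reduces to **`TwentyOnePrime ∧ PlaneLineFourBig`** (`sixFourResidue_of_two_pieces`,
`rls_six_four_of_two_pieces`): Theorem 21′ (`t = 3`, `g ≥ 10`) and the plane-line branch at `t = 4` with a plane trace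
of `≥ 8` points.
-/

namespace PercRepro.SixFour

open Finset ThmH PerFlat ThmN

/-- **`SixFourResidue` from the two remaining pieces of record.** -/
theorem sixFourResidue_of_two_pieces (h3b : TwentyOnePrime) (hγ : PlaneLineFourBig) : SixFourResidue :=
  sixFourResidue_of_three_pieces h3b planeAddTwoFour_holds hγ

/-- **C-025 at `(6, 4)` on every finite matroid from the two remaining pieces of record**: `RLS M 6 4`. -/
theorem rls_six_four_of_two_pieces {α : Type} (h3b : TwentyOnePrime) (hγ : PlaneLineFourBig) (M : Matroid α)
    [M.Finite] : RLS M 6 4 :=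
  rls_six_four_of_residue (sixFourResidue_of_two_pieces h3b hγ) M

end PercRepro.SixFour
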